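import Mathlib.Analysis.SpecialFunctions.Pow.Real
import HarnessLib

/-!
# Route `UnitScaleTilt`, crux K1 «MinimiserStabilityRegPr» (stmt-QuantumFields-19200), route-R E′ path (α′), row LEMMA-H-CURVED — FILE 2a:
# THE C¹ HERMITE (SMOOTHSTEP) PROFILE `θ_ℓ(r) = (1 − r∕ℓ)²(1 + 2r∕ℓ)` AND ITS LATTICE ROWS — values in `[0,1]`, `θ(0) = 1`, `θ(ℓ) = 0`, complement `θ(r) + θ(ℓ − r) = 1`,
# EXACT second difference `θ(r+1) − 2θ(r) + θ(r−1) = (12r − 6ℓ)∕ℓ³` (so `≤ 6∕ℓ²` in size on `[0, ℓ]`), knot value `θ(ℓ−1) = (3ℓ−2)∕ℓ³ ≤ 3∕ℓ²`, first difference `≤ 3∕ℓ`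

Cell `ym3-torus`, D-0154 (3c) twin-width seat `ym-routeR-w1` (gen 5); row «routeR-w1 g5: LEMMA-H-CURVED» (namer ★ym-ust-19200-p1 g14, 2026-08-28 17:33Z; «F-H2 GO» 17:48Z).
THEOREMS ONLY (0 `def`, 0 `sorry`); `--supports stmt-QuantumFields-19200`, count-neutral.  YM₃ on T³ is a ladder rung (R3), not the Clay problem; nothing here claims a stub, the
crux, d = 4 or the mass gap.

WHY.  LEMMA-H-curved = biharmonic Dirichlet principle (✓ `Prop7CentreBiharmonicDirichlet`, F-H1) + ONE explicit extension `Φ` of coarse centre data with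
`ℓ·Σ_x‖Δ_WΦ‖² ≤ C·Σ_c‖δ_c m‖² + (curved slack)`.  The extension is the tensor-product HERMITE BLEND of the `2^d` corner values of each dual cell (cells between adjacent
k-centres, side `ℓ = L^k`): weights `Π_μ θ_{ε_μ}(r_μ)`, `θ₀ = θ_ℓ`, `θ₁ = 1 − θ_ℓ = θ_ℓ(ℓ − ·)`.  A C⁰ blend (tent ∕ trilinear) is discrete-harmonic inside cells but its slope jumps
`δ²m∕ℓ` on the `≍ 3ℓ²` face sites cost one power of `ℓ` (`ℓ·Σ|ΔΦ|² ≍ ℓ·Σ(δ²m)²`); the C¹ profile below has ZERO slope at both knots (`θ′(0) = θ′(ℓ) = 0`), so ALL lattice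
second differences are `O(δm∕ℓ²)`: inside a cell `(A − B)·(12r − 6ℓ)∕ℓ³`, at a centre `η·(A′ − 2A + B)` with `η = θ(ℓ−1) = (3ℓ−2)∕ℓ³` — the two rows this file supplies
(`hermite_secondDiff`, `hermite_pred`).  No linear reproduction is needed: a C¹ partition of unity already gives LEMMA H's right side `Σ_c‖δ_c m‖²`.  THIS FILE is the
profile's one-dimensional real arithmetic; the lattice bookkeeping (dual-cell coordinates on `Site P 0`, the blend, the energy count `ℓ·Σ|ΔΦ|² ≤ 36d·4^d·Σ_c|δ_c m|²`) is
F-H2b∕F-H2c, the covariant transport F-H3.  The profile is written OUT (`(1 − r∕ℓ)²·(1 + 2r∕ℓ)`, a cubic POLYNOMIAL in `r` — no case split; it is only ever evaluated on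
`0 ≤ r ≤ ℓ`), so no definition is introduced.

WHAT IS PROVED (ns `…Theorems.Prop7HermiteProfile`; `ℓ, r : ℝ`).
* §1 values: `hermite_expand` (`= 1 − 3(r∕ℓ)² + 2(r∕ℓ)³`), `hermite_zero`, `hermite_self`, `hermite_add_hermite_sub` (`θ(r) + θ(ℓ−r) = 1`), `hermite_nonneg` (`0 ≤ r`), `hermite_le_one` (`r ≤ ℓ`),
  `hermite_pred` (`θ(ℓ−1) = (3ℓ−2)∕ℓ³`), `hermite_one` (`θ(1) = 1 − (3ℓ−2)∕ℓ³`), `hermite_pred_nonneg`, `hermite_pred_le` (`≤ 3∕ℓ²`).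
* §2 differences: ★ `hermite_secondDiff` (`θ(r+1) − 2θ(r) + θ(r−1) = (12r − 6ℓ)∕ℓ³`, all real `r`), ★ `abs_hermite_secondDiff_le` (`≤ 6∕ℓ²` on `0 ≤ r ≤ ℓ`),
  `hermite_sub_hermite` (first difference, closed form), `abs_hermite_sub_hermite_le` (`≤ 3∕ℓ` on `0 ≤ r`, `r + 1 ≤ ℓ`, `2 ≤ ℓ`).
HONEST SCOPE.  Elementary real algebra (`ring`∕`nlinarith`); the standard cubic Hermite basis function `h₀₀` of numerical analysis; nothing of Bałaban's is asserted.

References: T. Bałaban, CMP 95 (1984) 17–40 [Balaban1984PropagatorsI] ((1.29)–(1.31) p.23 — the role of LEMMA H); CMP 102 (1985) 277–309 [Balaban1985Variational]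
(Prop. 7 p.299).  The profile `h₀₀(t) = (1−t)²(1+2t) = 1 − 3t² + 2t³` is folklore (cubic Hermite interpolation).
-/

set_option autoImplicit false

noncomputable section

namespace Summit.QuantumFields.YangMills.Theorems.Prop7HermiteProfile

/-! ## §1 Values of the profile `θ_ℓ(r) = (1 − r∕ℓ)²(1 + 2r∕ℓ)` -/

/-- `θ_ℓ(r) = 1 − 3(r∕ℓ)² + 2(r∕ℓ)³`. [folklore] -/
theorem hermite_expand (ℓ r : ℝ) : (1 - r / ℓ) ^ 2 * (1 + 2 * r / ℓ) = 1 - 3 * (r / ℓ) ^ 2 + 2 * (r / ℓ) ^ 3 := by ring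

/-- `θ_ℓ(0) = 1`. [folklore] -/
theorem hermite_zero (ℓ : ℝ) : (1 - (0 : ℝ) / ℓ) ^ 2 * (1 + 2 * (0 : ℝ) / ℓ) = 1 := by simp

/-- `θ_ℓ(ℓ) = 0`. [folklore] -/
theorem hermite_self {ℓ : ℝ} (hℓ : ℓ ≠ 0) : (1 - ℓ / ℓ) ^ 2 * (1 + 2 * ℓ / ℓ) = 0 := by
  rw [div_self hℓ]; ring

/-- **COMPLEMENT ∕ PARTITION OF UNITY**: `θ_ℓ(r) + θ_ℓ(ℓ − r) = 1` (`h₀₀(t) + h₀₀(1−t) = 1`). [folklore] -/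
theorem hermite_add_hermite_sub {ℓ : ℝ} (hℓ : ℓ ≠ 0) (r : ℝ) :
    (1 - r / ℓ) ^ 2 * (1 + 2 * r / ℓ) + (1 - (ℓ - r) / ℓ) ^ 2 * (1 + 2 * (ℓ - r) / ℓ) = 1 := by
  field_simp
  ring

/-- `0 ≤ θ_ℓ(r)` for `0 ≤ r` (and `ℓ > 0`). [folklore] -/
theorem hermite_nonneg {ℓ r : ℝ} (hℓ : 0 < ℓ) (h0 : 0 ≤ r) : 0 ≤ (1 - r / ℓ) ^ 2 * (1 + 2 * r / ℓ) := by
  have : 0 ≤ 2 * r / ℓ := by positivity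
  positivity

/-- `θ_ℓ(r) ≤ 1` for `r ≤ ℓ` (and `ℓ > 0`). [folklore] -/
theorem hermite_le_one {ℓ r : ℝ} (hℓ : 0 < ℓ) (h1 : r ≤ ℓ) : (1 - r / ℓ) ^ 2 * (1 + 2 * r / ℓ) ≤ 1 := by
  have hc := hermite_add_hermite_sub hℓ.ne' r
  have hn : 0 ≤ (1 - (ℓ - r) / ℓ) ^ 2 * (1 + 2 * (ℓ - r) / ℓ) := hermite_nonneg hℓ (by linarith)
  linarith

/-- **THE KNOT VALUE**: `θ_ℓ(ℓ − 1) = (3ℓ − 2)∕ℓ³` (`= η`, the coefficient of the second difference at a centre). [folklore] -/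
theorem hermite_pred {ℓ : ℝ} (hℓ : ℓ ≠ 0) : (1 - (ℓ - 1) / ℓ) ^ 2 * (1 + 2 * (ℓ - 1) / ℓ) = (3 * ℓ - 2) / ℓ ^ 3 := by
  field_simp
  ring

/-- `θ_ℓ(1) = 1 − (3ℓ − 2)∕ℓ³`. [folklore] -/
theorem hermite_one {ℓ : ℝ} (hℓ : ℓ ≠ 0) : (1 - 1 / ℓ) ^ 2 * (1 + 2 * 1 / ℓ) = 1 - (3 * ℓ - 2) / ℓ ^ 3 := by
  field_simp
  ring

/-- `0 ≤ (3ℓ − 2)∕ℓ³` for `ℓ ≥ 1`. [folklore] -/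
theorem hermite_pred_nonneg {ℓ : ℝ} (hℓ : 1 ≤ ℓ) : 0 ≤ (3 * ℓ - 2) / ℓ ^ 3 := by
  have : 0 ≤ 3 * ℓ - 2 := by linarith
  positivity

/-- `(3ℓ − 2)∕ℓ³ ≤ 3∕ℓ²` for `ℓ ≥ 1`. [folklore] -/
theorem hermite_pred_le {ℓ : ℝ} (hℓ : 1 ≤ ℓ) : (3 * ℓ - 2) / ℓ ^ 3 ≤ 3 / ℓ ^ 2 := by
  have hℓ0 : 0 < ℓ := by linarith
  rw [div_le_div_iff₀ (by positivity) (by positivity)]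
  nlinarith [sq_nonneg ℓ, hℓ0]

/-! ## §2 Lattice differences of the profile -/

/-- ★ **THE EXACT SECOND DIFFERENCE**: `θ_ℓ(r+1) − 2θ_ℓ(r) + θ_ℓ(r−1) = (12r − 6ℓ)∕ℓ³` for every real `r` (the lattice second difference of a cubic is its second
derivative). [folklore] -/
theorem hermite_secondDiff {ℓ : ℝ} (hℓ : ℓ ≠ 0) (r : ℝ) :
    (1 - (r + 1) / ℓ) ^ 2 * (1 + 2 * (r + 1) / ℓ) - 2 * ((1 - r / ℓ) ^ 2 * (1 + 2 * r / ℓ)) + (1 - (r - 1) / ℓ) ^ 2 * (1 + 2 * (r - 1) / ℓ)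
      = (12 * r - 6 * ℓ) / ℓ ^ 3 := by
  field_simp
  ring

/-- ★ **SECOND DIFFERENCES ARE `O(ℓ⁻²)`**: `|θ_ℓ(r+1) − 2θ_ℓ(r) + θ_ℓ(r−1)| ≤ 6∕ℓ²` for `0 ≤ r ≤ ℓ`, `ℓ > 0`. [folklore] -/
theorem abs_hermite_secondDiff_le {ℓ r : ℝ} (hℓ : 0 < ℓ) (h0 : 0 ≤ r) (h1 : r ≤ ℓ) :
    |(1 - (r + 1) / ℓ) ^ 2 * (1 + 2 * (r + 1) / ℓ) - 2 * ((1 - r / ℓ) ^ 2 * (1 + 2 * r / ℓ)) + (1 - (r - 1) / ℓ) ^ 2 * (1 + 2 * (r - 1) / ℓ)|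
      ≤ 6 / ℓ ^ 2 := by
  rw [hermite_secondDiff hℓ.ne' r, abs_div, abs_of_pos (by positivity : (0 : ℝ) < ℓ ^ 3), div_le_div_iff₀ (by positivity) (by positivity)]
  have h6 : |12 * r - 6 * ℓ| ≤ 6 * ℓ := by
    rw [abs_le]; constructor <;> linarith
  calc |12 * r - 6 * ℓ| * ℓ ^ 2 ≤ 6 * ℓ * ℓ ^ 2 := mul_le_mul_of_nonneg_right h6 (by positivity)
    _ = 6 * ℓ ^ 3 := by ring

/-- The first difference in closed form: `θ_ℓ(r+1) − θ_ℓ(r) = (6r² + 6r + 2 − (6r + 3)ℓ)∕ℓ³`. [folklore] -/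
theorem hermite_sub_hermite {ℓ : ℝ} (hℓ : ℓ ≠ 0) (r : ℝ) :
    (1 - (r + 1) / ℓ) ^ 2 * (1 + 2 * (r + 1) / ℓ) - (1 - r / ℓ) ^ 2 * (1 + 2 * r / ℓ)
      = (6 * r ^ 2 + 6 * r + 2 - (6 * r + 3) * ℓ) / ℓ ^ 3 := by
  field_simp
  ring

/-- **FIRST DIFFERENCES ARE `O(ℓ⁻¹)`**: `|θ_ℓ(r+1) − θ_ℓ(r)| ≤ 3∕ℓ` for `0 ≤ r`, `r + 1 ≤ ℓ`, `ℓ ≥ 2` (the profile's slope is at most `3∕(2ℓ)`). [folklore] -/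
theorem abs_hermite_sub_hermite_le {ℓ r : ℝ} (hℓ : 2 ≤ ℓ) (h0 : 0 ≤ r) (h1 : r + 1 ≤ ℓ) :
    |(1 - (r + 1) / ℓ) ^ 2 * (1 + 2 * (r + 1) / ℓ) - (1 - r / ℓ) ^ 2 * (1 + 2 * r / ℓ)| ≤ 3 / ℓ := by
  have hℓ0 : 0 < ℓ := by linarith
  rw [hermite_sub_hermite hℓ0.ne' r, abs_div, abs_of_pos (by positivity : (0 : ℝ) < ℓ ^ 3), div_le_div_iff₀ (by positivity) hℓ0]
  have hup : 6 * r ^ 2 + 6 * r + 2 - (6 * r + 3) * ℓ ≤ 3 * ℓ ^ 2 := by nlinarith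
  have hlo : -(3 * ℓ ^ 2) ≤ 6 * r ^ 2 + 6 * r + 2 - (6 * r + 3) * ℓ := by nlinarith
  have h3 : |6 * r ^ 2 + 6 * r + 2 - (6 * r + 3) * ℓ| ≤ 3 * ℓ ^ 2 := abs_le.mpr ⟨hlo, hup⟩
  calc |6 * r ^ 2 + 6 * r + 2 - (6 * r + 3) * ℓ| * ℓ ≤ 3 * ℓ ^ 2 * ℓ := mul_le_mul_of_nonneg_right h3 hℓ0.le
    _ = 3 * ℓ ^ 3 := by ring

end Summit.QuantumFields.YangMills.Theorems.Prop7HermiteProfile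

end
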